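import Summits.QuantumFields.YangMills.Theorems.PoincareLipschitzLeungXinSphereIdentity

/-!
# Crux `HistoryTailL` (stmt-QuantumFields-19936), K2 organ of record «LOC-REG-MIN» (route crux `PoincareLipschitz.BlockLipschitzL`, stmt-QuantumFields-23533):
# THE LEUNG–XIN IDENTITY WITH A LATTICE TWIST — the summed second variation of a TWISTED bond energy `|p − R q̃|²` along the four conformal fields,
# its exact deviation from the flat value `2 + c²`, and the per-bond stability form: the twist costs a VOLUME term, nothing at first order

Cell `ym3-torus` (YM ladder rung R3 = continuum SU(2) Yang–Mills on the three-torus — a RUNG, NOT the Clay problem: not d = 4, not infinite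
volume, not a mass gap), TWIN-WIDTH seat `ym-ust-19936-w8` gen 6 (LEAD `ym-ust-19936-w1` g8 WORD 11, 2026-08-29T04:25Z: «GO — it is exactly the twist I left to
the pen»); `--supports stmt-QuantumFields-19936 --as helper`; THEOREMS ONLY, definition-free; imports FILE 1 ✓`…PoincareLipschitzLeungXinSphereIdentity` (LEAD w1 g8)
by name and nothing else (pure algebra in `ℝ⁴`).

WHY.  FILE 1 proves the FLAT Leung–Xin bond identity: for unit `p, q ∈ ℝ⁴` and the conformal fields `v_a(y) = e_a − (e_a·y)y`,
`Σ_a [2αβ·v_a(p)·v_a(q) − c(α²|v_a(p)|² + β²|v_a(q)|²)] = 2αβ(2 + c²) − 3c(α² + β²)`, `c = p·q` — the energy enters NEGATIVELY (`2 − n = −1`).  On the lattice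
the bond energy of the relative gauge `g` of a box-ℓ²-orbit minimiser is TWISTED: `e_b = |g(x) − R_b g(y)|²` with `R_b ∈ O(4)` the bond's transport
(`u ↦ V_b·u·W_b⁻¹` in quaternion letters — that dictionary is downstream), and varying `g(y)` along `v_a(g(y))` moves `q := R_b g(y)` along
`R_b v_a(g(y)) = v_{R_b e_a}(q)`.  So the bond Hessian pairs `v_a(p)` with the TWISTED frame `v_{R e_a}(q)`, and Xin's cross-sum `2 + c²` becomes

  `X(R) := Σ_a v_a(p)·v_{R e_a}(q) = tr R − (Rq̂)… ` — in this file's letters (the twisted frame = the ROWS `S a` of `S := Rᵀ`, acting by `S.mulVec`):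
  `X(S) = Σ_a S_{aa} − (S q)·q − p·(S p) + (p·q)·(p·(S q))`            (`sum_tang_dot_tangTwist`, ANY `S`),

and for ORTHOGONAL `S` (`S Sᵀ = 1`) and unit `p, q` the deviation from the flat value is EXACT:

  `X(S) = 2 + c² − (4 − tr S) + ½|S p − p|² + ½|S q − q|² + c·p·(S q − q)`,   `4 − tr S = ½‖S − 1‖_F²`   (`crossSum_twist_eq`, `four_sub_trace_eq_half_frob`)

— the twist enters through the trace defect (second order), two non-negative squares, and ONE first-order term `c·p·(Sq − q)`; splitting
`p·(Sq − q) = (p − q)·(Sq − q) + q·(Sq − q)` with `q·(Sq − q) = −½|Sq − q|²` trades the first-order term against the bond energy `e = |p − q|²`: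

  `4·(2 + c² − X(S)) ≤ 4(4 − tr S) + 4|S q − q|² + e`                                   (`four_mul_deviation_le`),

hence the PER-BOND STABILITY FORM (`α, β ≥ 0`):

  `6c(α² + β²) − 4αβ·X(S) ≤ 6c(α − β)² − αβ·e·(1 + e) + αβ·(4(4 − tr S) + 4|S q − q|²)`        (`secondVariation_twist_le`),

with `4(4 − tr S) + 4|Sq − q|² ≤ 6‖S − 1‖_F²` (`dev_le_frob`).  At a box-ℓ²-orbit MINIMISER the bond sum of the left side is `≥ 0` (FILE 1 §4's first-order-free
identity, read with `w := β·v_{S_b a}(q)`), so (`sum_weighted_energy_le`):  `Σ_b α_bβ_b·e_b(1 + e_b) ≤ Σ_b [6c_b(α_b − β_b)² + 6α_bβ_b‖S_b − 1‖_F²]` —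
LEUNG–XIN WITH TWIST: the cutoff-gradient term plus a VOLUME term, NOTHING at first order in the twist.  In a ball gauge with `|V_b − 1| ≤ Cθr`,
`|W_b − 1| ≤ Cθr + ε` one has `‖S_b − 1‖_F ≲ θr + ε`, whence the growth bound `E(B_r) ≲ r^{d−2} + (θr + ε)²r^{d}` behind LOC-REG-MIN's radius law
`C(r⁻¹ + θr²)` (LEAD ruling 04:20:47Z) — the hole-filling ∕ ε-regularity steps and the `SU(2) × SU(2) → SO(4)` dictionary are NOT here (the LOC-REG pen's).

WHAT (ns `…Theorems.PoincareLipschitzLeungXinTwistedIdentity`; vectors `Fin 4 → ℝ`, `dotProduct`, `e_a = Pi.single a 1`, twisted frame = rows `S a` of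
`S : Matrix (Fin 4) (Fin 4) ℝ`, `S *ᵥ q = S.mulVec q`, orthogonality `S * Sᵀ = 1`; everything spelled out, no definitions).
* §1 letters for orthogonal frames: `transpose_mul_self_of_mul_transpose_self`, `mulVec_dot_mulVec` (`(Sx)·(Sy) = x·y`), `row_dot_row`, `sum_row_dot_sq`
  (Parseval in the twisted frame), `sum_row_normSq` (`= 4`), ★`four_sub_trace_eq_half_frob` (`4 − tr S = ½‖S − 1‖_F²`), `normSq_mulVec_sub_le_frob`
  (`|Sq − q|² ≤ ‖S − 1‖_F²|q|²`).
* §2 ★`sum_tang_dot_tangTwist` (the twisted cross-sum, any `S`), `sum_tangTwist_normSq` (`Σ_a|v_{S a}(q)|² = 3`).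
* §3 ★`sum_bondHessian_twist_eq` (`= 2αβ·X(S) − 3c(α² + β²)`), ★★`crossSum_twist_eq` (exact deviation), ★★`four_mul_deviation_le` (root-free bound).
* §4 `normSq_sub_eq`, ★★`secondVariation_twist_le` (per-bond stability form), ★★`sum_weighted_energy_le` (bond sum under stability), `dev_le_frob`.
HONEST SCOPE.  Finite-dimensional algebra; nothing of LOC-REG-MIN, `hG`, the charts, `BlockLipschitzL`, `HistoryTailL` or any summit statement is proved.
YM₃ on T³ is rung R3, NOT the Clay problem.

References: Y. L. Xin, Duke Math. J. **47** (1980) 609–613 [Xin1980]; P.-F. Leung, Lecture Notes in Math. 949 (1982) 122–129; R. Schoen, K. Uhlenbeck,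
J. Differential Geom. **17** (1982) 307–335 and Invent. Math. **78** (1984) 89–100 (minimisers into spheres); T. Bałaban, Commun. Math. Phys. **98** (1985) 17–51
[Balaban1985Averaging] (§3, the inductive gauge regularity this organ replaces).
-/

set_option autoImplicit false

open scoped BigOperators
open Finset Matrix

namespace Summit.QuantumFields.YangMills.Theorems.PoincareLipschitzLeungXinTwistedIdentity

open Summit.QuantumFields.YangMills.Theorems.PoincareLipschitzLeungXinSphereIdentity (single_dot dot_single tang_dot sum_mul_eq_dot
  sum_tang_normSq)

/-! ## §1 Orthogonal frames in `ℝ⁴`: letters -/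

/-- Rows orthonormal ⇒ columns orthonormal (`S Sᵀ = 1 ⇒ Sᵀ S = 1`, square matrices). [folklore] -/
theorem transpose_mul_self_of_mul_transpose_self {S : Matrix (Fin 4) (Fin 4) ℝ} (hS : S * Sᵀ = 1) : Sᵀ * S = 1 :=
  mul_eq_one_comm.mp hS

/-- An orthogonal matrix preserves dot products: `(S x)·(S y) = x·y`. [folklore] -/
theorem mulVec_dot_mulVec {S : Matrix (Fin 4) (Fin 4) ℝ} (hS : S * Sᵀ = 1) (x y : Fin 4 → ℝ) :
    dotProduct (S *ᵥ x) (S *ᵥ y) = dotProduct x y := by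
  have hS' := transpose_mul_self_of_mul_transpose_self hS
  calc dotProduct (S *ᵥ x) (S *ᵥ y) = dotProduct (x ᵥ* Sᵀ) (S *ᵥ y) := by rw [Matrix.vecMul_transpose]
    _ = dotProduct x (Sᵀ *ᵥ (S *ᵥ y)) := (Matrix.dotProduct_mulVec _ _ _).symm
    _ = dotProduct x y := by rw [Matrix.mulVec_mulVec, hS', Matrix.one_mulVec]

/-- The rows of an orthogonal matrix are orthonormal: `(S a)·(S b) = δ_{ab}`. [folklore] -/
theorem row_dot_row {S : Matrix (Fin 4) (Fin 4) ℝ} (hS : S * Sᵀ = 1) (a b : Fin 4) :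
    dotProduct (S a) (S b) = if a = b then 1 else 0 := by
  have h := congrFun (congrFun hS a) b
  rw [Matrix.mul_apply, Matrix.one_apply] at h
  simpa only [Matrix.transpose_apply, dotProduct] using h

/-- `(S *ᵥ q) a = (S a)·q` (unfolding `mulVec`). [folklore] -/
theorem mulVec_apply_eq_dot (S : Matrix (Fin 4) (Fin 4) ℝ) (q : Fin 4 → ℝ) (a : Fin 4) : (S *ᵥ q) a = dotProduct (S a) q := rfl

/-- `Σ_a ((S a)·q)² = q·q` for orthogonal `S` (Parseval in the twisted frame). [folklore] -/
theorem sum_row_dot_sq {S : Matrix (Fin 4) (Fin 4) ℝ} (hS : S * Sᵀ = 1) (q : Fin 4 → ℝ) :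
    ∑ a : Fin 4, dotProduct (S a) q * dotProduct (S a) q = dotProduct q q := by
  rw [← mulVec_dot_mulVec hS q q]
  rfl

/-- `Σ_a |S a|² = 4` for orthogonal `S`. [folklore] -/
theorem sum_row_normSq {S : Matrix (Fin 4) (Fin 4) ℝ} (hS : S * Sᵀ = 1) : ∑ a : Fin 4, dotProduct (S a) (S a) = 4 := by
  simp only [row_dot_row hS, if_true]
  norm_num

/-- THE TRACE DEFECT IS HALF THE FROBENIUS DEVIATION: `4 − Σ_a S_{aa} = ½·Σ_{a,i}(S_{ai} − δ_{ai})²` for orthogonal `S`. [folklore] -/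
theorem four_sub_trace_eq_half_frob {S : Matrix (Fin 4) (Fin 4) ℝ} (hS : S * Sᵀ = 1) :
    4 - ∑ a : Fin 4, S a a = (1 / 2) * ∑ a : Fin 4, ∑ i : Fin 4, (S a i - (1 : Matrix (Fin 4) (Fin 4) ℝ) a i) ^ 2 := by
  have hrow : ∀ a : Fin 4, ∑ i : Fin 4, (S a i - (1 : Matrix (Fin 4) (Fin 4) ℝ) a i) ^ 2 = 2 - 2 * S a a := by
    intro a
    have h1 : ∑ i : Fin 4, (S a i - (1 : Matrix (Fin 4) (Fin 4) ℝ) a i) ^ 2 =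
        ∑ i : Fin 4, S a i * S a i - 2 * ∑ i : Fin 4, (1 : Matrix (Fin 4) (Fin 4) ℝ) a i * S a i +
          ∑ i : Fin 4, (1 : Matrix (Fin 4) (Fin 4) ℝ) a i * (1 : Matrix (Fin 4) (Fin 4) ℝ) a i := by
      rw [Finset.mul_sum, ← Finset.sum_sub_distrib, ← Finset.sum_add_distrib]
      refine Finset.sum_congr rfl fun i _ => ?_
      ring
    have h2 : ∑ i : Fin 4, (1 : Matrix (Fin 4) (Fin 4) ℝ) a i * S a i = S a a := by
      simp only [Matrix.one_apply, ite_mul, one_mul, zero_mul, Finset.sum_ite_eq, Finset.mem_univ, if_true]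
    have h3 : ∑ i : Fin 4, (1 : Matrix (Fin 4) (Fin 4) ℝ) a i * (1 : Matrix (Fin 4) (Fin 4) ℝ) a i = 1 := by
      simp only [Matrix.one_apply, mul_ite, mul_one, mul_zero, Finset.sum_ite_eq, Finset.mem_univ, if_true]
    have h4 : ∑ i : Fin 4, S a i * S a i = 1 := by
      have := row_dot_row hS a a
      rw [if_pos rfl] at this
      exact this
    rw [h1, h2, h3, h4]
    ring
  simp only [hrow]
  rw [Finset.sum_sub_distrib, ← Finset.mul_sum]
  simp only [Finset.sum_const, Finset.card_univ, Fintype.card_fin]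
  norm_num
  ring

/-- `|S q − q|² ≤ ‖S − 1‖_F²·|q|²` (Cauchy–Schwarz row by row). [folklore] -/
theorem normSq_mulVec_sub_le_frob (S : Matrix (Fin 4) (Fin 4) ℝ) (q : Fin 4 → ℝ) :
    dotProduct (S *ᵥ q - q) (S *ᵥ q - q) ≤ (∑ a : Fin 4, ∑ i : Fin 4, (S a i - (1 : Matrix (Fin 4) (Fin 4) ℝ) a i) ^ 2) * dotProduct q q := by
  -- `(S q − q) a = Σ_i (S − 1) a i q i`
  have hrow : ∀ a : Fin 4, (S *ᵥ q - q) a = ∑ i : Fin 4, (S a i - (1 : Matrix (Fin 4) (Fin 4) ℝ) a i) * q i := by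
    intro a
    have : (S *ᵥ q - q) a = ((S - 1) *ᵥ q) a := by rw [Matrix.sub_mulVec, Matrix.one_mulVec]
    rw [this]
    rfl
  have hq0 : 0 ≤ dotProduct q q := by
    show 0 ≤ ∑ i, q i * q i
    exact Finset.sum_nonneg fun i _ => mul_self_nonneg (q i)
  calc dotProduct (S *ᵥ q - q) (S *ᵥ q - q) = ∑ a : Fin 4, (∑ i : Fin 4, (S a i - (1 : Matrix (Fin 4) (Fin 4) ℝ) a i) * q i) ^ 2 := by
        show ∑ a, (S *ᵥ q - q) a * (S *ᵥ q - q) a = _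
        exact Finset.sum_congr rfl fun a _ => by rw [hrow a, sq]
    _ ≤ ∑ a : Fin 4, (∑ i : Fin 4, (S a i - (1 : Matrix (Fin 4) (Fin 4) ℝ) a i) ^ 2) * (∑ i : Fin 4, q i ^ 2) :=
        Finset.sum_le_sum fun a _ => Finset.sum_mul_sq_le_sq_mul_sq _ _ _
    _ = (∑ a : Fin 4, ∑ i : Fin 4, (S a i - (1 : Matrix (Fin 4) (Fin 4) ℝ) a i) ^ 2) * dotProduct q q := by
        rw [Finset.sum_mul]
        refine Finset.sum_congr rfl fun a _ => ?_
        congr 1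
        show ∑ i, q i ^ 2 = ∑ i, q i * q i
        exact Finset.sum_congr rfl fun i _ => sq (q i)

/-! ## §2 The twisted cross sum `X(S) = Σ_a v_a(p)·v_{S a}(q)` -/

/-- ★ **THE TWISTED XIN CROSS-SUM** (any `4 × 4` matrix `S`, any `p, q`; the twisted frame is the family of ROWS `S a`):
`Σ_a v_a(p)·v_{S a}(q) = Σ_a S_{aa} − (S q)·q − p·(S p) + (p·q)·(p·(S q))`, `v_r(q) := r − (r·q)q`.  At `S = 1` this is FILE 1's `2 + (p·q)²`.
[cite: Xin1980, p.609–613; folklore algebra] -/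
theorem sum_tang_dot_tangTwist (S : Matrix (Fin 4) (Fin 4) ℝ) (p q : Fin 4 → ℝ) :
    ∑ a : Fin 4, dotProduct (Pi.single a 1 - dotProduct (Pi.single a 1) p • p) (S a - dotProduct (S a) q • q) =
      ∑ a : Fin 4, S a a - dotProduct (S *ᵥ q) q - dotProduct p (S *ᵥ p) + dotProduct p q * dotProduct p (S *ᵥ q) := by
  have hterm : ∀ a : Fin 4, dotProduct (Pi.single a 1 - dotProduct (Pi.single a 1) p • p) (S a - dotProduct (S a) q • q) =
      S a a - dotProduct (S a) q * q a - p a * dotProduct (S a) p + p a * dotProduct (S a) q * dotProduct p q := by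
    intro a
    rw [tang_dot, Pi.sub_apply, Pi.smul_apply, smul_eq_mul, dotProduct_sub, dotProduct_smul, smul_eq_mul, dotProduct_comm p (S a)]
    ring
  simp only [hterm]
  rw [Finset.sum_add_distrib, Finset.sum_sub_distrib, Finset.sum_sub_distrib]
  have e1 : ∑ a : Fin 4, dotProduct (S a) q * q a = dotProduct (S *ᵥ q) q := rfl
  have e2 : ∑ a : Fin 4, p a * dotProduct (S a) p = dotProduct p (S *ᵥ p) := rfl
  have e3 : ∑ a : Fin 4, p a * dotProduct (S a) q * dotProduct p q = dotProduct p q * dotProduct p (S *ᵥ q) := by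
    rw [show dotProduct p (S *ᵥ q) = ∑ a : Fin 4, p a * dotProduct (S a) q from rfl, Finset.mul_sum]
    exact Finset.sum_congr rfl fun a _ => by ring
  rw [e1, e2, e3]

/-- `Σ_a |v_{S a}(q)|² = 3` for orthogonal `S` and unit `q` (`|v_r(q)|² = |r|² − (r·q)²`; Σ|S a|² = 4, Σ((S a)·q)² = |q|² = 1). [folklore] -/
theorem sum_tangTwist_normSq {S : Matrix (Fin 4) (Fin 4) ℝ} (hS : S * Sᵀ = 1) (q : Fin 4 → ℝ) (hq : dotProduct q q = 1) :
    ∑ a : Fin 4, dotProduct (S a - dotProduct (S a) q • q) (S a - dotProduct (S a) q • q) = 3 := by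
  have hterm : ∀ a : Fin 4, dotProduct (S a - dotProduct (S a) q • q) (S a - dotProduct (S a) q • q) =
      dotProduct (S a) (S a) - dotProduct (S a) q * dotProduct (S a) q := by
    intro a
    rw [sub_dotProduct, dotProduct_sub, dotProduct_sub, smul_dotProduct, dotProduct_smul, dotProduct_smul, smul_dotProduct, hq,
      dotProduct_comm q (S a)]
    simp only [smul_eq_mul]
    ring
  simp only [hterm]
  rw [Finset.sum_sub_distrib, sum_row_normSq hS, sum_row_dot_sq hS q, hq]
  norm_num

/-! ## §3 The twisted summed bond Hessian and its exact deviation from the flat value `2 + c²` -/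

/-- ★ **THE TWISTED LEUNG–XIN BOND IDENTITY.**  For orthogonal `S`, unit `p, q`, reals `α, β`, `c = p·q`:
`Σ_a [2αβ·v_a(p)·v_{S a}(q) − c·(α²|v_a(p)|² + β²|v_{S a}(q)|²)] = 2αβ·X(S) − 3c(α² + β²)`,
`X(S) = Σ_a S_{aa} − (S q)·q − p·(S p) + c·(p·(S q))` — the sum over the four conformal fields of the second `t`-derivative at `0` of
`γ_p^{αv_a}(t)·γ_q^{βv_{S a}}(t)` (FILE 1 §4 gives the variation, with `w := β·v_{S a}(q)`). [cite: Xin1980, p.609–613] -/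
theorem sum_bondHessian_twist_eq {S : Matrix (Fin 4) (Fin 4) ℝ} (hS : S * Sᵀ = 1) (p q : Fin 4 → ℝ) (hp : dotProduct p p = 1)
    (hq : dotProduct q q = 1) (α β : ℝ) :
    ∑ a : Fin 4, (2 * α * β * dotProduct (Pi.single a 1 - dotProduct (Pi.single a 1) p • p) (S a - dotProduct (S a) q • q) -
        dotProduct p q * (α ^ 2 * dotProduct (Pi.single a 1 - dotProduct (Pi.single a 1) p • p) (Pi.single a 1 - dotProduct (Pi.single a 1) p • p) +
          β ^ 2 * dotProduct (S a - dotProduct (S a) q • q) (S a - dotProduct (S a) q • q))) =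
      2 * α * β * (∑ a : Fin 4, S a a - dotProduct (S *ᵥ q) q - dotProduct p (S *ᵥ p) + dotProduct p q * dotProduct p (S *ᵥ q)) -
        3 * dotProduct p q * (α ^ 2 + β ^ 2) := by
  rw [Finset.sum_sub_distrib, ← Finset.mul_sum, sum_tang_dot_tangTwist S p q, ← Finset.mul_sum, Finset.sum_add_distrib, ← Finset.mul_sum,
    ← Finset.mul_sum, sum_tang_normSq p hp, sum_tangTwist_normSq hS q hq]
  ring

/-- ★★ **EXACT DEVIATION OF THE TWISTED CROSS-SUM FROM `2 + c²`.**  For orthogonal `S` and unit `p, q`: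
`X(S) = 2 + (p·q)² − (4 − Σ_a S_{aa}) + ½|S p − p|² + ½|S q − q|² + (p·q)·(p·(S q − q))` — the twist enters through the trace defect
`4 − tr S = ½‖S − 1‖_F²` (§1), two non-negative squares, and ONE first-order term `c·p·(Sq − q)`. [cite: Xin1980, p.609–613; folklore algebra] -/
theorem crossSum_twist_eq {S : Matrix (Fin 4) (Fin 4) ℝ} (hS : S * Sᵀ = 1) (p q : Fin 4 → ℝ) (hp : dotProduct p p = 1)
    (hq : dotProduct q q = 1) :
    ∑ a : Fin 4, S a a - dotProduct (S *ᵥ q) q - dotProduct p (S *ᵥ p) + dotProduct p q * dotProduct p (S *ᵥ q) =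
      2 + dotProduct p q ^ 2 - (4 - ∑ a : Fin 4, S a a) + (1 / 2) * dotProduct (S *ᵥ p - p) (S *ᵥ p - p) +
        (1 / 2) * dotProduct (S *ᵥ q - q) (S *ᵥ q - q) + dotProduct p q * dotProduct p (S *ᵥ q - q) := by
  have hu : dotProduct (S *ᵥ p) (S *ᵥ p) = 1 := by rw [mulVec_dot_mulVec hS, hp]
  have hw : dotProduct (S *ᵥ q) (S *ᵥ q) = 1 := by rw [mulVec_dot_mulVec hS, hq]
  have e1 : dotProduct (S *ᵥ p - p) (S *ᵥ p - p) = 2 - 2 * dotProduct p (S *ᵥ p) := by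
    rw [sub_dotProduct, dotProduct_sub, dotProduct_sub, hu, hp, dotProduct_comm (S *ᵥ p) p]
    ring
  have e2 : dotProduct (S *ᵥ q - q) (S *ᵥ q - q) = 2 - 2 * dotProduct (S *ᵥ q) q := by
    rw [sub_dotProduct, dotProduct_sub, dotProduct_sub, hw, hq, dotProduct_comm q (S *ᵥ q)]
    ring
  have e3 : dotProduct p (S *ᵥ q - q) = dotProduct p (S *ᵥ q) - dotProduct p q := by rw [dotProduct_sub]
  rw [e1, e2, e3]
  ring

/-- ★★ **THE DEVIATION, BOUNDED WITHOUT SQUARE ROOTS** (orthogonal `S`, unit `p, q`, `c = p·q`, `e = |p − q|²`):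
`4·(2 + c² − X(S)) ≤ 4·(4 − Σ_a S_{aa}) + 4·|S q − q|² + e` — from §3's exact form: drop `½|Sp − p|² ≥ 0`, split
`p·(Sq − q) = (p − q)·(Sq − q) + q·(Sq − q)` with `q·(Sq − q) = −½|Sq − q|²` and `|(p−q)·(Sq−q)| ≤ ¼e + |Sq − q|²`, `|c| ≤ 1`. [folklore] -/
theorem four_mul_deviation_le {S : Matrix (Fin 4) (Fin 4) ℝ} (hS : S * Sᵀ = 1) (p q : Fin 4 → ℝ) (hp : dotProduct p p = 1)
    (hq : dotProduct q q = 1) :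
    4 * (2 + dotProduct p q ^ 2 -
        (∑ a : Fin 4, S a a - dotProduct (S *ᵥ q) q - dotProduct p (S *ᵥ p) + dotProduct p q * dotProduct p (S *ᵥ q))) ≤
      4 * (4 - ∑ a : Fin 4, S a a) + 4 * dotProduct (S *ᵥ q - q) (S *ᵥ q - q) + dotProduct (p - q) (p - q) := by
  rw [crossSum_twist_eq hS p q hp hq]
  -- letters: `w := S q − q`, `u := S p − p`, `c := p·q`, `d := p − q`
  have hw : dotProduct (S *ᵥ q) (S *ᵥ q) = 1 := by rw [mulVec_dot_mulVec hS, hq]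
  have hqw : dotProduct q (S *ᵥ q - q) = -(1 / 2) * dotProduct (S *ᵥ q - q) (S *ᵥ q - q) := by
    rw [dotProduct_sub, sub_dotProduct, dotProduct_sub, dotProduct_sub, hw, hq, dotProduct_comm q (S *ᵥ q)]
    ring
  have hsplit : dotProduct p (S *ᵥ q - q) = dotProduct (p - q) (S *ᵥ q - q) + dotProduct q (S *ᵥ q - q) := by
    rw [sub_dotProduct]; ring
  have hu0 : 0 ≤ dotProduct (S *ᵥ p - p) (S *ᵥ p - p) := by
    show 0 ≤ ∑ i, (S *ᵥ p - p) i * (S *ᵥ p - p) i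
    exact Finset.sum_nonneg fun i _ => mul_self_nonneg _
  have hw0 : 0 ≤ dotProduct (S *ᵥ q - q) (S *ᵥ q - q) := by
    show 0 ≤ ∑ i, (S *ᵥ q - q) i * (S *ᵥ q - q) i
    exact Finset.sum_nonneg fun i _ => mul_self_nonneg _
  -- `|c| ≤ 1` (Cauchy–Schwarz)
  have hc : |dotProduct p q| ≤ 1 := by
    rw [← sq_le_one_iff_abs_le_one]
    have h := Finset.sum_mul_sq_le_sq_mul_sq (Finset.univ : Finset (Fin 4)) p q
    have hp' : ∑ i : Fin 4, p i ^ 2 = 1 := by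
      rw [← hp]; exact Finset.sum_congr rfl fun i _ => sq (p i)
    have hq' : ∑ i : Fin 4, q i ^ 2 = 1 := by
      rw [← hq]; exact Finset.sum_congr rfl fun i _ => sq (q i)
    rw [hp', hq', mul_one] at h
    exact h
  -- `|(p − q)·w| ≤ ¼|p − q|² + |w|²`
  have ht : |dotProduct (p - q) (S *ᵥ q - q)| ≤ (1 / 4) * dotProduct (p - q) (p - q) + dotProduct (S *ᵥ q - q) (S *ᵥ q - q) := by
    have hcs := Finset.sum_mul_sq_le_sq_mul_sq (Finset.univ : Finset (Fin 4)) (p - q) (S *ᵥ q - q)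
    have hd : ∑ i : Fin 4, (p - q) i ^ 2 = dotProduct (p - q) (p - q) := Finset.sum_congr rfl fun i _ => sq _
    have hw' : ∑ i : Fin 4, (S *ᵥ q - q) i ^ 2 = dotProduct (S *ᵥ q - q) (S *ᵥ q - q) := Finset.sum_congr rfl fun i _ => sq _
    rw [hd, hw'] at hcs
    have hd0 : 0 ≤ dotProduct (p - q) (p - q) := by
      show 0 ≤ ∑ i, (p - q) i * (p - q) i
      exact Finset.sum_nonneg fun i _ => mul_self_nonneg _
    refine abs_le_of_sq_le_sq ?_ (by positivity)
    calc dotProduct (p - q) (S *ᵥ q - q) ^ 2 ≤ dotProduct (p - q) (p - q) * dotProduct (S *ᵥ q - q) (S *ᵥ q - q) := hcs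
      _ ≤ ((1 / 4) * dotProduct (p - q) (p - q) + dotProduct (S *ᵥ q - q) (S *ᵥ q - q)) ^ 2 := by
          nlinarith [sq_nonneg ((1 / 4) * dotProduct (p - q) (p - q) - dotProduct (S *ᵥ q - q) (S *ᵥ q - q))]
  have hct : -(dotProduct p q * dotProduct (p - q) (S *ᵥ q - q)) ≤ |dotProduct (p - q) (S *ᵥ q - q)| := by
    have h1 := neg_abs_le (dotProduct p q * dotProduct (p - q) (S *ᵥ q - q))
    rw [abs_mul] at h1
    have h2 : |dotProduct p q| * |dotProduct (p - q) (S *ᵥ q - q)| ≤ |dotProduct (p - q) (S *ᵥ q - q)| :=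
      mul_le_of_le_one_left (abs_nonneg _) hc
    linarith
  have hcw : dotProduct p q * dotProduct (S *ᵥ q - q) (S *ᵥ q - q) ≤ dotProduct (S *ᵥ q - q) (S *ᵥ q - q) :=
    mul_le_of_le_one_left hw0 (abs_le.mp hc).2
  rw [hsplit, hqw]
  nlinarith [hu0, hw0, ht, hct, hcw]

/-! ## §4 The per-bond stability form and its bond sum -/

/-- `|p − q|² = 2 − 2·(p·q)` for unit `p, q`. [folklore] -/
theorem normSq_sub_eq (p q : Fin 4 → ℝ) (hp : dotProduct p p = 1) (hq : dotProduct q q = 1) :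
    dotProduct (p - q) (p - q) = 2 - 2 * dotProduct p q := by
  rw [sub_dotProduct, dotProduct_sub, dotProduct_sub, hp, hq, dotProduct_comm q p]
  ring

/-- ★★ **THE TWISTED SECOND VARIATION, PER BOND** (orthogonal `S`, unit `p, q`, amplitudes `α, β ≥ 0`, `c = p·q`, `e = |p − q|²`):
`6c(α² + β²) − 4αβ·X(S) ≤ 6c(α − β)² − αβ·e·(1 + e) + αβ·(4(4 − Σ_a S_{aa}) + 4|S q − q|²)` — FILE 1's flat form
`6c(α−β)² − 2αβe(1 + e∕2)` plus the twist's VOLUME term; no first-order twist survives (it was traded against `αβ·e` by §3).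
At a box-ℓ²-orbit MINIMISER the bond sum of the left side is `≥ 0` (FILE 1 §4, `w := β·v_{S_b a}(q)`), whence `sum_weighted_energy_le`.
[cite: Xin1980, p.609–613] -/
theorem secondVariation_twist_le {S : Matrix (Fin 4) (Fin 4) ℝ} (hS : S * Sᵀ = 1) (p q : Fin 4 → ℝ) (hp : dotProduct p p = 1)
    (hq : dotProduct q q = 1) {α β : ℝ} (hα : 0 ≤ α) (hβ : 0 ≤ β) :
    6 * dotProduct p q * (α ^ 2 + β ^ 2) -
        4 * α * β * (∑ a : Fin 4, S a a - dotProduct (S *ᵥ q) q - dotProduct p (S *ᵥ p) + dotProduct p q * dotProduct p (S *ᵥ q)) ≤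
      6 * dotProduct p q * (α - β) ^ 2 - α * β * dotProduct (p - q) (p - q) * (1 + dotProduct (p - q) (p - q)) +
        α * β * (4 * (4 - ∑ a : Fin 4, S a a) + 4 * dotProduct (S *ᵥ q - q) (S *ᵥ q - q)) := by
  have hdev := mul_le_mul_of_nonneg_left (four_mul_deviation_le hS p q hp hq) (mul_nonneg hα hβ)
  have he := normSq_sub_eq p q hp hq
  rw [he] at hdev ⊢
  nlinarith [hdev]

/-- ★★ **STABILITY ⇒ WEIGHTED ENERGY BOUND** (the bond sum; abstract index set).  If every bond `b ∈ s` satisfies §4's per-bond inequality with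
data `c_b, e_b, α_b, β_b, X_b, dev_b` and the summed second variation is non-negative (`0 ≤ Σ_b [6c_b(α_b² + β_b²) − 4α_bβ_bX_b]`, minimality), then
`Σ_b α_bβ_b·e_b·(1 + e_b) ≤ Σ_b [6c_b(α_b − β_b)² + α_bβ_b·dev_b]` — Leung–Xin with twist: the cutoff-gradient term plus a VOLUME term.
[cite: Xin1980, p.609–613] -/
theorem sum_weighted_energy_le {ι : Type*} (s : Finset ι) (c e α β X dev : ι → ℝ)
    (hb : ∀ b ∈ s, 6 * c b * (α b ^ 2 + β b ^ 2) - 4 * α b * β b * X b ≤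
      6 * c b * (α b - β b) ^ 2 - α b * β b * e b * (1 + e b) + α b * β b * dev b)
    (hstab : 0 ≤ ∑ b ∈ s, (6 * c b * (α b ^ 2 + β b ^ 2) - 4 * α b * β b * X b)) :
    ∑ b ∈ s, α b * β b * e b * (1 + e b) ≤ ∑ b ∈ s, (6 * c b * (α b - β b) ^ 2 + α b * β b * dev b) := by
  have h1 : ∑ b ∈ s, (6 * c b * (α b ^ 2 + β b ^ 2) - 4 * α b * β b * X b) ≤
      ∑ b ∈ s, (6 * c b * (α b - β b) ^ 2 - α b * β b * e b * (1 + e b) + α b * β b * dev b) := Finset.sum_le_sum hb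
  have h2 : ∑ b ∈ s, (6 * c b * (α b - β b) ^ 2 - α b * β b * e b * (1 + e b) + α b * β b * dev b) =
      ∑ b ∈ s, (6 * c b * (α b - β b) ^ 2 + α b * β b * dev b) - ∑ b ∈ s, α b * β b * e b * (1 + e b) := by
    rw [← Finset.sum_sub_distrib]
    exact Finset.sum_congr rfl fun b _ => by ring
  linarith

/-- **THE VOLUME TERM IN FROBENIUS LETTERS**: `4(4 − Σ_a S_{aa}) + 4|S q − q|² ≤ 6·‖S − 1‖_F²` for orthogonal `S` and unit `q` (§1). [folklore] -/
theorem dev_le_frob {S : Matrix (Fin 4) (Fin 4) ℝ} (hS : S * Sᵀ = 1) (q : Fin 4 → ℝ) (hq : dotProduct q q = 1) :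
    4 * (4 - ∑ a : Fin 4, S a a) + 4 * dotProduct (S *ᵥ q - q) (S *ᵥ q - q) ≤
      6 * ∑ a : Fin 4, ∑ i : Fin 4, (S a i - (1 : Matrix (Fin 4) (Fin 4) ℝ) a i) ^ 2 := by
  have h1 := four_sub_trace_eq_half_frob hS
  have h2 := normSq_mulVec_sub_le_frob S q
  rw [hq, mul_one] at h2
  linarith

end Summit.QuantumFields.YangMills.Theorems.PoincareLipschitzLeungXinTwistedIdentity
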